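import Mathlib

/-!
# Cut parity and linearity glue (stub `stub_cutspan` of line `kotzig-cutspan`, crux
`SymmetryBudget.HamCompiles`, item stmt-PneNP-10637) — auxiliary file 1

Pure combinatorics / linear algebra over `ZMod 2`, independent of the line's definitions:

* `cutParity`: for a nonempty "support" `U ⊆ Fin g` with anchor `min' U` and an edge relation `E`
  on `Fin g` all of whose edges lie inside `U`, the number of indicator vectors `S : Fin g → Bool`
  with `S ⊆ U`, `S (min' U) = true` and `S` constant on every edge is ODD iff the graph
  `SimpleGraph.fromRel E` is connected on `U` (Bodlaender–Cygan–Kratsch–Nederlof 2015, §3.1, the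
  "cut parity" behind Cut&Count; here proved by the fixed-point-free involution `S ↦ S ∆ C` for a
  component `C ⊆ U` missing the anchor, so no component counting is needed);
* `exists_mem_span_pairing_iff`: a vector of a span with odd pairing against a fixed vector exists
  iff some generator has odd pairing (the pairing is a linear functional).
-/

-- `Summit.PneNP.PneNP.…` duplicates `PneNP` BY DESIGN (single-problem summit, D-0017).
set_option linter.dupNamespace false

namespace Summit.PneNP.PneNP.Theorems.HamCompilesKC

open Finset

namespace Cutspan

/-! ### Reachability bookkeeping for `SimpleGraph.fromRel` -/

section Reach

variable {g : ℕ}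

/-- Along a reachability step of `fromRel E` a property preserved by `E`-edges (in both
directions) is preserved. -/
theorem reachable_fromRel_induct (E : Fin g → Fin g → Prop) (Q : Fin g → Prop)
    (hQ : ∀ i j, E i j → (Q i ↔ Q j)) {i j : Fin g}
    (h : (SimpleGraph.fromRel E).Reachable i j) : Q i ↔ Q j := by
  rw [SimpleGraph.reachable_iff_reflTransGen] at h
  induction h with
  | refl => exact Iff.rfl
  | tail _ hadj ih =>
    rw [SimpleGraph.fromRel_adj] at hadj
    rcases hadj.2 with h1 | h1
    · exact ih.trans (hQ _ _ h1)
    · exact ih.trans (hQ _ _ h1).symm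

/-- If all edges of `E` lie inside `U`, reachability from a vertex of `U` stays inside `U`. -/
theorem mem_of_reachable_fromRel (E : Fin g → Fin g → Prop) (U : Finset (Fin g))
    (hE : ∀ i j, E i j → i ∈ U ∧ j ∈ U) {i j : Fin g} (hi : i ∈ U)
    (h : (SimpleGraph.fromRel E).Reachable i j) : j ∈ U := by
  rw [SimpleGraph.reachable_iff_reflTransGen] at h
  induction h with
  | refl => exact hi
  | tail _ hadj _ =>
    rw [SimpleGraph.fromRel_adj] at hadj
    rcases hadj.2 with h1 | h1
    · exact (hE _ _ h1).2
    · exact (hE _ _ h1).1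

end Reach

/-! ### Cut parity -/

section CutParity

variable {g : ℕ}

/-- In `ZMod 2`, `1 + 1 = 0`. -/
theorem zmod2_one_add_one : (1 : ZMod 2) + 1 = 0 := by decide

/-- **Cut parity** (Bodlaender–Cygan–Kratsch–Nederlof 2015, §3.1). Let `U ⊆ Fin g` be nonempty
with anchor `a = min' U`, and `E` an edge relation with all edges inside `U`. For a (decidable)
predicate `P` on indicator vectors equivalent to "`S ⊆ U`, `S a = true`, and `S` is constant on
every `E`-edge", the `GF(2)`-count `∑_S [P S]` equals `1` iff `fromRel E` is connected on `U`.
(If connected, the only such `S` is the indicator of `U`; otherwise flipping `S` on a component of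
`U` missing the anchor is a fixed-point-free involution of `{S | P S}`.) -/
theorem cutParity {g : ℕ} (U : Finset (Fin g)) (hU : U.Nonempty) (E : Fin g → Fin g → Prop)
    (hE : ∀ i j, E i j → i ∈ U ∧ j ∈ U) (P : (Fin g → Bool) → Prop) [DecidablePred P]
    (hP : ∀ S, P S ↔ (∀ i, S i = true → i ∈ U) ∧ S (U.min' hU) = true ∧
      ∀ i j, E i j → (S i = true ↔ S j = true)) :
    (∑ S : Fin g → Bool, if P S then (1 : ZMod 2) else 0) = 1 ↔
      ∀ i ∈ U, ∀ j ∈ U, (SimpleGraph.fromRel E).Reachable i j := by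
  classical
  set a := U.min' hU with ha
  have haU : a ∈ U := U.min'_mem hU
  constructor
  · -- contrapositive: a component of `U` missing the anchor gives an involution
    intro hsum
    by_contra hconn
    have hk : ∃ k ∈ U, ¬ (SimpleGraph.fromRel E).Reachable a k := by
      by_contra hall
      push Not at hall
      exact hconn fun i hi j hj => (hall i hi).symm.trans (hall j hj)
    obtain ⟨k, hkU, hk⟩ := hk
    -- the component of `k`
    let C : Finset (Fin g) := univ.filter fun l => (SimpleGraph.fromRel E).Reachable k l
    have hkC : k ∈ C := by simp [C]
    have haC : a ∉ C := by
      simp only [C, mem_filter, mem_univ, true_and]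
      exact fun h => hk h.symm
    have hCU : ∀ l ∈ C, l ∈ U := by
      intro l hl
      simp only [C, mem_filter, mem_univ, true_and] at hl
      exact mem_of_reachable_fromRel E U hE hkU hl
    have hCE : ∀ i j, E i j → (i ∈ C ↔ j ∈ C) := by
      intro i j hij
      simp only [C, mem_filter, mem_univ, true_and]
      by_cases heq : i = j
      · rw [heq]
      · have hadj : (SimpleGraph.fromRel E).Adj i j := by
          rw [SimpleGraph.fromRel_adj]; exact ⟨heq, Or.inl hij⟩
        exact ⟨fun h => h.trans hadj.reachable, fun h => h.trans hadj.symm.reachable⟩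
    -- the flip
    let flip : (Fin g → Bool) → (Fin g → Bool) := fun S l => if l ∈ C then !S l else S l
    have hflip_inv : ∀ S, flip (flip S) = S := by
      intro S; funext l
      by_cases hl : l ∈ C <;> simp [flip, hl]
    have hflip_ne : ∀ S, flip S ≠ S := by
      intro S h
      have := congrFun h k
      simp only [flip, if_pos hkC] at this
      cases hS : S k <;> simp [hS] at this
    have hflipP : ∀ S, P S → P (flip S) := by
      intro S hS
      rw [hP] at hS ⊢
      obtain ⟨hsub, hanc, hedge⟩ := hS
      refine ⟨?_, ?_, ?_⟩
      · intro l hl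
        by_cases hlC : l ∈ C
        · exact hCU l hlC
        · simp only [flip, if_neg hlC] at hl
          exact hsub l hl
      · simp only [flip, if_neg haC]
        exact hanc
      · intro i j hij
        have hC := hCE i j hij
        have hS := hedge i j hij
        by_cases hiC : i ∈ C
        · have hjC : j ∈ C := hC.1 hiC
          simp only [flip, if_pos hiC, if_pos hjC]
          cases hi : S i <;> cases hj : S j <;> simp_all
        · have hjC : j ∉ C := fun h => hiC (hC.2 h)
          simp only [flip, if_neg hiC, if_neg hjC]
          exact hS
    have hflipP' : ∀ S, P S ↔ P (flip S) :=
      fun S => ⟨hflipP S, fun h => hflip_inv S ▸ hflipP (flip S) h⟩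
    have hzero : (∑ S : Fin g → Bool, if P S then (1 : ZMod 2) else 0) = 0 := by
      refine Finset.sum_involution (fun S _ => flip S) ?_ ?_ ?_ ?_
      · intro S _
        by_cases hS : P S
        · rw [if_pos hS, if_pos ((hflipP' S).1 hS)]
          exact zmod2_one_add_one
        · rw [if_neg hS, if_neg (fun h => hS ((hflipP' S).2 h))]
          simp
      · intro S _ _
        exact hflip_ne S
      · intro S _
        exact mem_univ _
      · intro S _
        exact hflip_inv S
    rw [hzero] at hsum
    exact zero_ne_one hsum
  · -- connected: the indicator of `U` is the only admissible `S`
    intro hconn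
    let one : Fin g → Bool := fun l => decide (l ∈ U)
    have hPiff : ∀ S, P S ↔ S = one := by
      intro S
      rw [hP]
      constructor
      · rintro ⟨hsub, hanc, hedge⟩
        funext l
        by_cases hl : l ∈ U
        · have hreach := hconn a haU l hl
          have := reachable_fromRel_induct E (fun i => S i = true) hedge hreach
          simp only [one, hl, decide_true]
          exact this.1 hanc
        · simp only [one, hl, decide_false]
          cases hS : S l
          · rfl
          · exact absurd (hsub l hS) hl
      · rintro rfl
        refine ⟨fun l hl => by simpa [one] using hl, by simpa [one] using haU, ?_⟩
        intro i j hij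
        obtain ⟨hi, hj⟩ := hE i j hij
        simp [one, hi, hj]
    simp_rw [hPiff]
    rw [Finset.sum_ite_eq']
    simp
end CutParity

/-! ### Linearity glue -/

section Linearity

variable {ι : Type*} [Fintype ι]

/-- In `ZMod 2` a value different from `1` is `0`. -/
theorem zmod2_eq_zero_of_ne_one : ∀ a : ZMod 2, a ≠ 1 → a = 0 := by decide

/-- **Linearity glue** (set-indexed spans): a vector of `span T` with odd pairing against `v`
exists iff some member of `T` has odd pairing (the pairing `w ↦ ∑_S w S · v S` is a linear
functional, so it vanishes on a span iff it vanishes on the generators). -/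
theorem exists_mem_span_pairing_iff (T : Set (ι → ZMod 2)) (v : ι → ZMod 2) :
    (∃ w ∈ Submodule.span (ZMod 2) T, ∑ S, w S * v S = 1) ↔ ∃ t ∈ T, ∑ S, t S * v S = 1 := by
  let φ : (ι → ZMod 2) →ₗ[ZMod 2] ZMod 2 :=
    { toFun := fun w => ∑ S, w S * v S
      map_add' := fun a b => by
        simp only [Pi.add_apply, add_mul, Finset.sum_add_distrib]
      map_smul' := fun c a => by
        simp only [Pi.smul_apply, smul_eq_mul, RingHom.id_apply, Finset.mul_sum, mul_assoc] }
  constructor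
  · rintro ⟨w, hw, h1⟩
    by_contra hall
    push Not at hall
    have hle : Submodule.span (ZMod 2) T ≤ LinearMap.ker φ := by
      rw [Submodule.span_le]
      intro t ht
      exact zmod2_eq_zero_of_ne_one _ (hall t ht)
    have : φ w = 0 := hle hw
    exact zero_ne_one (this.symm.trans h1)
  · rintro ⟨t, ht, h1⟩
    exact ⟨t, Submodule.subset_span ht, h1⟩

end Linearity

end Cutspan

end Summit.PneNP.PneNP.Theorems.HamCompilesKC
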